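import Summits.ValiantsHypothesis.ValiantsHypothesis.Theorems.GrenetZeonTwoDimCoefficientsDualUnipotentRankFlat
import Summits.ValiantsHypothesis.ValiantsHypothesis.Theorems.GrenetZeonDualUnipotentThreeHalvesPermRankOfLineFlat
import Literature.LinearAlgebra.GMSPermanentalRankSubspace
import Literature.LinearAlgebra.GMSPermanentalRankSubspaceHolds

/-!
# Crux `GrenetZeon.TwoDimCoefficients` (stmt-ValiantsHypothesis-8062), stub `stub_dualUnipotent` (`DualUnipotentBound`):
# RANK-`r` DIRECTION SUBSPACES OF THE UNIPOTENT FACTOR HAVE DIMENSION ≤ (r + 1)·n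

The dimension consequence of ✓ `RankFlat.totalDegree_lineSubst_perPoly_le_rank` (p818140): in the unipotent dual model
`per_n = α·det A + β·tr(adj A·B)` (`det A ≡ c`), a direction subspace `K ≤ ℂ^{n×n}` on which the linear part of `A` has rank `≤ r`
EVERYWHERE (`rank lin_v A ≤ r` for all `v ∈ K`) is LINE-FLAT of order `r + 1` for `per_n`, hence (S1 ✓ `SlowPlanes.permRank_of_lineFlat`)
consists of matrices of permanental rank `≤ r + 1`, hence (S2 = GUTERMAN–MESHULAM–SPIRIDONOV 2023 Cor. 1.6, ✓ PROVED in the tree: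
`Literature.LinearAlgebra.GutermanMeshulamSpiridonov2023_cor_1_6_holds`) has `dim K ≤ (r + 1)·n` (`finrank_le_of_rank_le`).
The case `r = 0` is the kernel bound behind the best proved rung `m ≥ √2·n` (✓ `two_mul_sq_le_of_dualUnipotentRepr`, p593595, there with
`2n`; here `dim ker(lin A) ≤ n`, `finrank_ker_le_of_dualUnipotentRepr`).  The bridge `prk_le_of_permRankLE'` is the Theorems-side twin of
`RadicalSplit.prk_le_of_permRankLE` (crux workfile `Cruxes/DualUnipotentThreeHalves/Lines/radical_split.lean` §2b, not importable here).
Honest framing: a support lemma (`--supports stmt-ValiantsHypothesis-8062`); no new rung follows from it alone (bounded-rank subspaces of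
`M_m` have codimension `≥ m(m − r)`); `DualUnipotentBound`, 8062, 24318, `VP ≠ VNP` remain OPEN / NOT proved.  No sorry, no definitions,
no new named facts (GMS Cor. 1.6 is proved in the tree).
-/

-- single-conjunct layout: Sub = Summit, duplicated namespace component intended (the name is mandated)
set_option linter.dupNamespace false
set_option autoImplicit false

noncomputable section

namespace Summit.ValiantsHypothesis.ValiantsHypothesis.Cruxes.TwoDimCoefficients.DimTwoCases.RankFlat

open MvPolynomial Matrix
open Literature.Computability.AlgebraicComplexity (perPoly)
open Summit.ValiantsHypothesis.ValiantsHypothesis.Cruxes.TwoDimCoefficients.DimTwoCases (AffMat IsAffine DualUnipotentRepr)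
open Summit.ValiantsHypothesis.ValiantsHypothesis.Theorems.GrenetZeon.RadicalSplit (lineSubst)
open Summit.ValiantsHypothesis.ValiantsHypothesis.Theorems.GrenetZeon.SlowCore (linEntry lineSubst_eq_aeval)
open Summit.ValiantsHypothesis.ValiantsHypothesis.Theorems.GrenetZeon.SlowPlanes (permRank_of_lineFlat)

variable {n m : ℕ}

/-- Theorems-side twin of `RadicalSplit.prk_le_of_permRankLE`: if all `(k+1) × (k+1)` subpermanents of `v` along injections vanish, the
tree's permanental rank of the matrix `(v (i,j))` is `≤ k`. [folklore; via ✓ `forall_rsubperm_eq_zero_iff_prk_lt`] -/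
theorem prk_le_of_permRankLE' {k : ℕ} {v : Fin n × Fin n → ℂ}
    (h : ∀ (r c : Fin (k + 1) ↪ Fin n), (Matrix.of fun i j => v (r i, c j)).permanent = 0) :
    Literature.Computability.AlgebraicComplexity.BoraleviCarliniMichalekVentura2025.prk
      (Matrix.of fun i j : Fin n => v (i, j)) ≤ k := by
  classical
  set A : Matrix (Fin n) (Fin n) ℂ := Matrix.of fun i j : Fin n => v (i, j) with hA
  have hlt : Literature.Computability.AlgebraicComplexity.BoraleviCarliniMichalekVentura2025.prk A < k + 1 := by
    rw [← Literature.Computability.AlgebraicComplexity.BoraleviCarliniMichalekVentura2025.forall_rsubperm_eq_zero_iff_prk_lt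
      A (h := k + 1) (by omega)]
    intro Rw Cl hR hC
    have eR : Fin (k + 1) ≃ {j // j ∈ Rw} :=
      (Finset.equivFinOfCardEq hR).symm.trans (Equiv.subtypeEquivRight (fun _ => Iff.rfl))
    have eC : Fin (k + 1) ≃ {i // i ∈ Cl} :=
      (Finset.equivFinOfCardEq hC).symm.trans (Equiv.subtypeEquivRight (fun _ => Iff.rfl))
    rw [Literature.Computability.AlgebraicComplexity.BoraleviCarliniMichalekVentura2025.rsubperm_eq_subperm,
      Matrix.subperm_eq_permanent_of_equiv A eC eR]
    let r : Fin (k + 1) ↪ Fin n := ⟨fun a => (eR a : Fin n), fun a b hab => eR.injective (Subtype.ext hab)⟩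
    let c : Fin (k + 1) ↪ Fin n := ⟨fun a => (eC a : Fin n), fun a b hab => eC.injective (Subtype.ext hab)⟩
    have hmat : (Matrix.of fun a b => A (eR a : Fin n) (eC b : Fin n)) = Matrix.of fun i j => v (r i, c j) := by
      ext a b; simp [hA, r, c]
    rw [hmat]
    exact h r c
  omega

/-- GMS Cor. 1.6 transported to `Fin n × Fin n → ℂ` with "all `(k+1) × (k+1)` subpermanents vanish": `dim K ≤ k·n`.
(Theorems-side twin of `RadicalSplit.gmsBound_of_fact` + `stub_gms`; GMS 2023 Cor. 1.6 = ✓ `Literature.LinearAlgebra.GutermanMeshulamSpiridonov2023_cor_1_6_holds`.) [this file] -/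
theorem finrank_le_of_permRankLE {k : ℕ} (K : Submodule ℂ (Fin n × Fin n → ℂ))
    (hK : ∀ v ∈ K, ∀ (r c : Fin (k + 1) ↪ Fin n), (Matrix.of fun i j => v (r i, c j)).permanent = 0) :
    Module.finrank ℂ K ≤ k * n := by
  classical
  let e : (Fin n × Fin n → ℂ) ≃ₗ[ℂ] Matrix (Fin n) (Fin n) ℂ :=
    (LinearEquiv.curry ℂ ℂ (Fin n) (Fin n)).trans (LinearEquiv.refl ℂ _)
  have hW : ∀ A ∈ K.map (e : (Fin n × Fin n → ℂ) →ₗ[ℂ] Matrix (Fin n) (Fin n) ℂ),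
      Literature.Computability.AlgebraicComplexity.BoraleviCarliniMichalekVentura2025.prk A ≤ k := by
    intro A hA
    obtain ⟨v, hv, rfl⟩ := Submodule.mem_map.1 hA
    have : (e : (Fin n × Fin n → ℂ) →ₗ[ℂ] _) v = Matrix.of fun i j : Fin n => v (i, j) := by
      ext i j; rfl
    rw [this]
    exact prk_le_of_permRankLE' (hK v hv)
  have h := Literature.LinearAlgebra.GutermanMeshulamSpiridonov2023_cor_1_6_holds ℂ n k
    (K.map (e : (Fin n × Fin n → ℂ) →ₗ[ℂ] Matrix (Fin n) (Fin n) ℂ)) hW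
  rwa [LinearEquiv.finrank_map_eq] at h

/-- ★★ **RANK-`r` DIRECTION SUBSPACES HAVE DIMENSION ≤ (r + 1)·n.**  In the unipotent dual model (`det A ≡ c`,
`per_n = α·det A + β·tr(adj A·B)`), every direction subspace `K` with `rank lin_v A ≤ r` for all `v ∈ K` satisfies
`dim K ≤ (r + 1)·n`: line-degree `≤ r + 1` (✓ `totalDegree_lineSubst_perPoly_le_rank`) ⇒ permanental rank `≤ r + 1` along `K`
(✓ S1 `permRank_of_lineFlat`) ⇒ GMS. [this file] -/
theorem finrank_le_of_rank_le (α β c : ℂ) (A B : AffMat n m) (hA : IsAffine A) (hB : IsAffine B)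
    (hdet : A.det = MvPolynomial.C c)
    (hper : perPoly (Fin n) ℂ = MvPolynomial.C α * A.det + MvPolynomial.C β * (A.adjugate * B).trace)
    (K : Submodule ℂ (Fin n × Fin n → ℂ)) (r : ℕ)
    (hK : ∀ v ∈ K, (Matrix.of fun i j : Fin m => linEntry A i j v).rank ≤ r) :
    Module.finrank ℂ K ≤ (r + 1) * n := by
  refine finrank_le_of_permRankLE K fun v hv => ?_
  refine permRank_of_lineFlat n (r + 1) K (fun x w hw => ?_) v hv
  rw [← lineSubst_eq_aeval]
  exact totalDegree_lineSubst_perPoly_le_rank α β c A B hA hB hdet hper x w (hK w hw)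

/-- ★ **MODEL FORM**: `DualUnipotentRepr n m` ⇒ an affine `m × m` pencil `A` all of whose rank-`≤ r` direction subspaces have dimension
`≤ (r + 1)·n`, for every `r`. [this file] -/
theorem exists_pencil_finrank_le_of_dualUnipotentRepr (h : DualUnipotentRepr n m) :
    ∃ A : AffMat n m, IsAffine A ∧ ∀ (K : Submodule ℂ (Fin n × Fin n → ℂ)) (r : ℕ),
      (∀ v ∈ K, (Matrix.of fun i j : Fin m => linEntry A i j v).rank ≤ r) → Module.finrank ℂ K ≤ (r + 1) * n := by
  obtain ⟨α, β, c, A, B, hA, hB, _, hdet, hper⟩ := h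
  exact ⟨A, hA, fun K r hK => finrank_le_of_rank_le α β c A B hA hB hdet hper K r hK⟩

/-- The `r = 0` case: the kernel of the linear part of the unipotent factor has dimension `≤ n` (the flatness count of the `√2·n` rung,
with GMS in place of the Hessian-isotropy lemma's `2n`). [this file] -/
theorem finrank_ker_le_of_dualUnipotentRepr (α β c : ℂ) (A B : AffMat n m) (hA : IsAffine A) (hB : IsAffine B)
    (hdet : A.det = MvPolynomial.C c)
    (hper : perPoly (Fin n) ℂ = MvPolynomial.C α * A.det + MvPolynomial.C β * (A.adjugate * B).trace)
    (K : Submodule ℂ (Fin n × Fin n → ℂ)) (hK : ∀ v ∈ K, ∀ i j, linEntry A i j v = 0) :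
    Module.finrank ℂ K ≤ n := by
  have h := finrank_le_of_rank_le α β c A B hA hB hdet hper K 0 fun v hv => by
    have h0 : (Matrix.of fun i j : Fin m => linEntry A i j v) = 0 := by
      ext i j; rw [Matrix.of_apply, hK v hv i j, Matrix.zero_apply]
    rw [h0, Matrix.rank_zero]
  simpa using h

/-! ## §2 Permanental rank of a direction is dominated by the coefficient-rank of the unipotent factor -/

/-- ★ **`prk(v) ≤ rank(lin_v A) + 1` for EVERY direction `v`.**  In the unipotent dual model, the permanental rank of the `n × n`
matrix `v` is at most one more than the rank of the linear coefficient matrix of `A` along `v`: the line `ℂ·v` is a direction space of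
coefficient-rank `≤ rank(lin_v A)`, hence line-flat of order `rank(lin_v A) + 1` (✓ `totalDegree_lineSubst_perPoly_le_rank`), hence of
permanental rank `≤ rank(lin_v A) + 1` (✓ S1 `permRank_of_lineFlat`). [this file] -/
theorem prk_le_rank_succ (α β c : ℂ) (A B : AffMat n m) (hA : IsAffine A) (hB : IsAffine B)
    (hdet : A.det = MvPolynomial.C c)
    (hper : perPoly (Fin n) ℂ = MvPolynomial.C α * A.det + MvPolynomial.C β * (A.adjugate * B).trace)
    (v : Fin n × Fin n → ℂ) :
    Literature.Computability.AlgebraicComplexity.BoraleviCarliniMichalekVentura2025.prk (Matrix.of fun i j : Fin n => v (i, j)) ≤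
      (Matrix.of fun i j : Fin m => linEntry A i j v).rank + 1 := by
  classical
  set r : ℕ := (Matrix.of fun i j : Fin m => linEntry A i j v).rank with hr
  refine prk_le_of_permRankLE' (k := r + 1) ?_
  refine permRank_of_lineFlat n (r + 1) (ℂ ∙ v) (fun x w hw => ?_) v (Submodule.mem_span_singleton_self v)
  rw [← lineSubst_eq_aeval]
  refine totalDegree_lineSubst_perPoly_le_rank α β c A B hA hB hdet hper x w ?_
  obtain ⟨t, rfl⟩ := Submodule.mem_span_singleton.mp hw
  have hsm : (Matrix.of fun i j : Fin m => linEntry A i j (t • v)) =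
      Matrix.diagonal (fun _ : Fin m => t) * Matrix.of fun i j : Fin m => linEntry A i j v := by
    rw [← Matrix.smul_eq_diagonal_mul]
    ext i j
    rw [Matrix.of_apply, Matrix.smul_apply, Matrix.of_apply, smul_eq_mul,
      Summit.ValiantsHypothesis.ValiantsHypothesis.Theorems.GrenetZeon.LongMassRankOne.linEntry_smul]
  rw [hsm]
  exact (Matrix.rank_mul_le_right _ _).trans le_rfl

/-- ★ **TRANSVERSAL FORM: a direction with nonzero permanent has coefficient-rank `≥ n − 1`.**  If the `n × n` matrix `v` has
`per v ≠ 0` (e.g. `v` a permutation matrix, or the all-ones direction), then `n ≤ rank(lin_v A) + 1`. [this file] -/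
theorem le_rank_succ_of_permanent_ne_zero (α β c : ℂ) (A B : AffMat n m) (hA : IsAffine A) (hB : IsAffine B)
    (hdet : A.det = MvPolynomial.C c)
    (hper : perPoly (Fin n) ℂ = MvPolynomial.C α * A.det + MvPolynomial.C β * (A.adjugate * B).trace)
    (v : Fin n × Fin n → ℂ) (hv : (Matrix.of fun i j : Fin n => v (i, j)).permanent ≠ 0) :
    n ≤ (Matrix.of fun i j : Fin m => linEntry A i j v).rank + 1 := by
  classical
  refine le_trans ?_ (prk_le_rank_succ α β c A B hA hB hdet hper v)
  refine Literature.Computability.AlgebraicComplexity.BoraleviCarliniMichalekVentura2025.le_prk_of_rsubperm_ne_zero _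
    (Rw := Finset.univ) (Cl := Finset.univ) ?_ ?_ ?_
  · rw [Finset.card_univ, Fintype.card_fin]
  · rw [Finset.card_univ, Fintype.card_fin]
  · rw [Literature.Computability.AlgebraicComplexity.BoraleviCarliniMichalekVentura2025.rsubperm_congr _
      (p' := fun _ => True) (q' := fun _ => True) (fun i => by simp) (fun j => by simp),
      Literature.Computability.AlgebraicComplexity.BoraleviCarliniMichalekVentura2025.rsubperm_eq_subperm,
      Matrix.subperm_true]
    exact hv

/-- The IDENTITY direction: `per 1 = 1 ≠ 0`, so the DIAGONAL coordinates' coefficient matrices `[x_(i,i)] A` have total rank `≥ n − 1`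
in the sense `n ≤ rank(Σ_i [x_(i,i)] A) + 1`. [this file] -/
theorem le_rank_succ_diagonal (α β c : ℂ) (A B : AffMat n m) (hA : IsAffine A) (hB : IsAffine B)
    (hdet : A.det = MvPolynomial.C c)
    (hper : perPoly (Fin n) ℂ = MvPolynomial.C α * A.det + MvPolynomial.C β * (A.adjugate * B).trace) :
    n ≤ (Matrix.of fun i j : Fin m => linEntry A i j (fun e : Fin n × Fin n => if e.1 = e.2 then (1 : ℂ) else 0)).rank + 1 := by
  classical
  refine le_rank_succ_of_permanent_ne_zero α β c A B hA hB hdet hper _ ?_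
  have h1 : (Matrix.of fun i j : Fin n => (fun e : Fin n × Fin n => if e.1 = e.2 then (1 : ℂ) else 0) (i, j)) = 1 := by
    ext i j
    rw [Matrix.of_apply, Matrix.one_apply]
  rw [h1, Matrix.permanent_one]
  exact one_ne_zero

end Summit.ValiantsHypothesis.ValiantsHypothesis.Cruxes.TwoDimCoefficients.DimTwoCases.RankFlat

end
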